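import Mathlib
import Literature.NumberTheory.Sieve.Maynard2016BumpData
import HarnessLib

/-!
# Maynard 2016, Lemma 8: the functionals of `F(10t)` (the substitution `t ↦ 10t`, proved)

Topic `Literature/NumberTheory/Sieve`. J. Maynard, *Large gaps between primes*, Ann. of Math. (2)
183 (2016), 915–933 = arXiv:1408.5110, §8, proof of Lemma 8 ("`F` is a smooth approximation to
`F_k(10t_1, …, 10t_k)` supported on `Σ t_i ≤ 1/10` with
`J^{(1)}(F)/I^{(1)}(F) ≥ (1/10 − ε) J(F_k)/I(F_k)`").

The factor `1/10` is the substitution `t ↦ 10t`; we prove the two identities behind it for every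
`F` supported in the unit simplex `R_k` (`k ≥ 1`):

* `integral_sq_smul_ten` : `∫_{t ≥ 0} F(10t)² dt = 10^{−k} I_k(F)`;
* `integral_J_smul_ten`  : `∫_{t_i ∈ [0,1], t_ℓ ≥ 0 (ℓ≠i)} (∫_{u ≥ 0} F(10·(t; t_i := u)) du)² dt = 10^{−k−1} J_k^{(i)}(F)`

(`I_k`, `J_k^{(i)}` = the tree's `maynardI`, `maynardJ`). The second is obtained WITHOUT Fubini: the
inner substitution `u ↦ 10u` and the linear change of variables by the diagonal matrix
`diag(10, …, 1 (at i), …, 10)` (determinant `10^{k−1}`; `Real.map_matrix_volume_pi_eq_smul_volume_pi`),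
under which the integrand — which does not depend on `t_i` — is invariant in form.

Consequently the approximation fact `BumpDensity` (`Maynard2016BumpData`) follows from its scaled form
`ScaledDensity`, in which the targets are the functionals of `t ↦ F(10t)` themselves (no factor `10`,
no `maynardI`/`maynardJ`): `bumpDensity_of_scaledDensity`, hence
`theorem1_of_lemma7_scaledDensity : Lemma7 → ScaledDensity → Maynard2016_theorem1`.

## References

* J. Maynard, *Large gaps between primes*, Ann. of Math. (2) 183 (2016), 915–933; arXiv:1408.5110,
  Lemma 8 (proof, "`F_k(10t_1,…,10t_k)`"). [Maynard2016LargeGaps]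
-/

open Filter Finset MeasureTheory Set
open scoped Topology ContDiff Matrix

namespace Literature.NumberTheory.Sieve

namespace Maynard2016

/-! ### Support bookkeeping -/

/-- If `F` is supported in `R_k` and some coordinate of `s` is negative or exceeds `1`, then
`F s = 0`. [cite: Maynard2015, §2 (R_k ⊆ [0,1]^k)] -/
theorem apply_eq_zero_of_not_mem_Icc {k : ℕ} {F : (Fin k → ℝ) → ℝ}
    (hF : Function.support F ⊆ maynardSimplex k) {s : Fin k → ℝ} {ℓ : Fin k}
    (hs : s ℓ ∉ Set.Icc (0 : ℝ) 1) : F s = 0 := by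
  by_contra h
  have hmem : s ∈ maynardCube k := maynardSimplex_subset_maynardCube k (hF h)
  exact hs (hmem ℓ (Set.mem_univ _))

/-! ### `I`: the substitution `t ↦ 10t` in all coordinates -/

/-- **`∫_{t ≥ 0} F(10t)² dt = 10^{−k} I_k(F)`** for `F` supported in `R_k`. [cite: Maynard2016LargeGaps, Lemma 8 (proof, "F_k(10t)")] -/
theorem integral_sq_smul_ten {k : ℕ} (F : (Fin k → ℝ) → ℝ)
    (hF : Function.support F ⊆ maynardSimplex k) :
    ∫ t in Set.univ.pi (fun _ : Fin k => Set.Ici (0 : ℝ)), F ((10 : ℝ) • t) ^ 2 =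
      maynardI k F / 10 ^ k := by
  -- both sides are integrals over the whole space
  have h1 : ∫ t in Set.univ.pi (fun _ : Fin k => Set.Ici (0 : ℝ)), F ((10 : ℝ) • t) ^ 2 =
      ∫ t, F ((10 : ℝ) • t) ^ 2 := by
    refine setIntegral_eq_integral_of_forall_compl_eq_zero fun t ht => ?_
    have : ∃ ℓ, t ℓ < 0 := by
      by_contra h
      exact ht (Set.mem_univ_pi.2 fun ℓ => Set.mem_Ici.2 (not_lt.1 fun hlt => h ⟨ℓ, hlt⟩))
    obtain ⟨ℓ, hℓ⟩ := this
    have : F ((10 : ℝ) • t) = 0 :=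
      apply_eq_zero_of_not_mem_Icc hF (ℓ := ℓ) (by
        simp only [Pi.smul_apply, smul_eq_mul, Set.mem_Icc, not_and_or, not_le]
        exact Or.inl (by linarith))
    rw [this, zero_pow two_ne_zero]
  have h2 : maynardI k F = ∫ t, F t ^ 2 := by
    unfold maynardI
    refine setIntegral_eq_integral_of_forall_compl_eq_zero fun t ht => ?_
    have : F t = 0 := by
      by_contra h
      exact ht (hF h)
    rw [this, zero_pow two_ne_zero]
  rw [h1, h2, Measure.integral_comp_smul volume (fun s => F s ^ 2) 10]
  have hfr : Module.finrank ℝ (Fin k → ℝ) = k := by simp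
  rw [hfr, smul_eq_mul, abs_of_pos (by positivity), div_eq_inv_mul]

/-! ### `J`: the substitution in the free coordinates -/

/-- The scaling vector `(10, …, 1 (at i), …, 10)`. [cite: Maynard2016LargeGaps, Lemma 8 (proof)] -/
noncomputable def scaleVec {k : ℕ} (i : Fin k) : Fin k → ℝ := fun ℓ => if ℓ = i then 1 else 10

/-- `scaleVec i ℓ ≠ 0`. [cite: Maynard2016LargeGaps, Lemma 8 (proof)] -/
theorem scaleVec_ne_zero {k : ℕ} (i ℓ : Fin k) : scaleVec i ℓ ≠ 0 := by
  unfold scaleVec; split_ifs <;> norm_num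

/-- `scaleVec i ℓ > 0`. [cite: Maynard2016LargeGaps, Lemma 8 (proof)] -/
theorem scaleVec_pos {k : ℕ} (i ℓ : Fin k) : 0 < scaleVec i ℓ := by
  unfold scaleVec; split_ifs <;> norm_num

/-- `det diag(scaleVec i) = 10^n` on `Fin (n+1)`. [cite: Maynard2016LargeGaps, Lemma 8 (proof)] -/
theorem det_diagonal_scaleVec {n : ℕ} (i : Fin (n + 1)) :
    (Matrix.diagonal (scaleVec i)).det = 10 ^ n := by
  rw [Matrix.det_diagonal, Fin.prod_univ_succAbove _ i]
  have h1 : scaleVec i i = 1 := if_pos rfl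
  have h2 : ∀ j : Fin n, scaleVec i (i.succAbove j) = 10 := fun j => if_neg (Fin.succAbove_ne i j)
  simp_rw [h1, h2, Finset.prod_const, Finset.card_univ, Fintype.card_fin, one_mul]

/-- The coordinatewise scaling by `scaleVec i` as a measurable equivalence. [cite: Maynard2016LargeGaps, Lemma 8 (proof)] -/
noncomputable def scaleEquiv {k : ℕ} (i : Fin k) : (Fin k → ℝ) ≃ᵐ (Fin k → ℝ) :=
  MeasurableEquiv.piCongrRight fun ℓ => MeasurableEquiv.mulLeft₀ (scaleVec i ℓ) (scaleVec_ne_zero i ℓ)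

/-- `scaleEquiv i t = (scaleVec i ℓ · t_ℓ)_ℓ`. [cite: Maynard2016LargeGaps, Lemma 8 (proof)] -/
theorem scaleEquiv_apply {k : ℕ} (i : Fin k) (t : Fin k → ℝ) (ℓ : Fin k) :
    scaleEquiv i t ℓ = scaleVec i ℓ * t ℓ := rfl

/-- `scaleEquiv i` is the linear map of the diagonal matrix. [cite: Maynard2016LargeGaps, Lemma 8 (proof)] -/
theorem coe_scaleEquiv {k : ℕ} (i : Fin k) :
    (⇑(scaleEquiv i) : (Fin k → ℝ) → (Fin k → ℝ)) = ⇑(Matrix.toLin' (Matrix.diagonal (scaleVec i))) := by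
  funext t
  funext ℓ
  rw [scaleEquiv_apply, Matrix.toLin'_apply, Matrix.mulVec_diagonal]

/-- **Change of variables**: `∫ G(scaleEquiv i t) dt = 10^{−n} ∫ G` on `ℝ^{n+1}` (no measurability of
`G` needed). [cite: Maynard2016LargeGaps, Lemma 8 (proof)] -/
theorem integral_comp_scaleEquiv {n : ℕ} (i : Fin (n + 1)) (G : (Fin (n + 1) → ℝ) → ℝ) :
    ∫ t, G (scaleEquiv i t) = (10 ^ n)⁻¹ * ∫ s, G s := by
  rw [← integral_map_equiv (scaleEquiv i) G, coe_scaleEquiv,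
    Real.map_matrix_volume_pi_eq_smul_volume_pi (by rw [det_diagonal_scaleVec]; positivity),
    integral_smul_measure, det_diagonal_scaleVec, ENNReal.toReal_ofReal (abs_nonneg _),
    abs_of_pos (by positivity), smul_eq_mul]

/-- `10 • (t; t_i := u) = (scaleEquiv i t; ·_i := 10u)`. [cite: Maynard2016LargeGaps, Lemma 8 (proof)] -/
theorem smul_update_eq {k : ℕ} (i : Fin k) (t : Fin k → ℝ) (u : ℝ) :
    (10 : ℝ) • Function.update t i u = Function.update (scaleEquiv i t) i (10 * u) := by
  funext ℓ
  by_cases h : ℓ = i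
  · subst h
    simp
  · rw [Pi.smul_apply, Function.update_of_ne h, Function.update_of_ne h, scaleEquiv_apply,
      smul_eq_mul]
    unfold scaleVec
    rw [if_neg h]

/-- The fibre integral `Φ_i(s) = ∫_{v > 0} F(s; s_i := v) dv`. [cite: Maynard2016LargeGaps, Lemma 7 (definition of J^(1))] -/
noncomputable def fibreInt {k : ℕ} (F : (Fin k → ℝ) → ℝ) (i : Fin k) (s : Fin k → ℝ) : ℝ :=
  ∫ v in Set.Ioi (0 : ℝ), F (Function.update s i v)

/-- The inner integral of the scaled function: `∫_{u>0} F(10·(t; t_i := u)) du = Φ_i(scaleEquiv i t)/10`.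
[cite: Maynard2016LargeGaps, Lemma 8 (proof)] -/
theorem inner_smul_ten {k : ℕ} (F : (Fin k → ℝ) → ℝ) (i : Fin k) (t : Fin k → ℝ) :
    ∫ u in Set.Ioi (0 : ℝ), F ((10 : ℝ) • Function.update t i u) =
      10⁻¹ * fibreInt F i (scaleEquiv i t) := by
  simp_rw [smul_update_eq]
  rw [integral_comp_mul_left_Ioi (fun v => F (Function.update (scaleEquiv i t) i v)) 0
    (by norm_num : (0 : ℝ) < 10), mul_zero, smul_eq_mul]
  rfl

/-- For `F` supported in `R_k`: `Φ_i(s) = ∫_0^1 (1_{R_k} F)(s; s_i := u) du` (the inner integral of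
`maynardJ`). [cite: Maynard2015, display before Prop. 4.1] -/
theorem fibreInt_eq_intervalIntegral {k : ℕ} {F : (Fin k → ℝ) → ℝ}
    (hF : Function.support F ⊆ maynardSimplex k) (i : Fin k) (s : Fin k → ℝ) :
    fibreInt F i s = ∫ u in (0 : ℝ)..1, (maynardSimplex k).indicator F (Function.update s i u) := by
  have hind : (maynardSimplex k).indicator F = F := Set.indicator_eq_self.2 hF
  rw [hind, intervalIntegral.integral_of_le zero_le_one]
  unfold fibreInt
  refine setIntegral_eq_of_subset_of_forall_sdiff_eq_zero measurableSet_Ioi Set.Ioc_subset_Ioi_self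
    fun v hv => ?_
  have hv1 : 1 < v := by
    have h1 := hv.1
    have h2 := hv.2
    simp only [Set.mem_Ioi, Set.mem_Ioc, not_and_or, not_le] at h1 h2
    rcases h2 with h2 | h2
    · exact absurd h1 h2
    · exact h2
  exact apply_eq_zero_of_not_mem_Icc hF (ℓ := i)
    (by rw [Function.update_self]; exact fun h => absurd h.2 (not_le.2 hv1))

/-- If `s_ℓ > 1` for some `ℓ ≠ i` then `Φ_i(s) = 0` (`F` supported in `R_k`). [cite: Maynard2015, §2 (R_k ⊆ [0,1]^k)] -/
theorem fibreInt_eq_zero {k : ℕ} {F : (Fin k → ℝ) → ℝ} (hF : Function.support F ⊆ maynardSimplex k)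
    {i ℓ : Fin k} (hℓ : ℓ ≠ i) {s : Fin k → ℝ} (hs : s ℓ ∉ Set.Icc (0 : ℝ) 1) : fibreInt F i s = 0 := by
  unfold fibreInt
  refine (setIntegral_congr_fun measurableSet_Ioi fun v _ => ?_).trans (integral_zero _ _)
  exact apply_eq_zero_of_not_mem_Icc hF (ℓ := ℓ) (by rwa [Function.update_of_ne hℓ])

/-- The outer set `{t_i ∈ [0,1], t_ℓ ≥ 0 (ℓ ≠ i)}` is measurable. [cite: Maynard2016LargeGaps, Lemma 7 (definition of J^(1))] -/
theorem measurableSet_outer {k : ℕ} (i : Fin k) :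
    MeasurableSet (Set.univ.pi (fun ℓ : Fin k => if ℓ = i then Set.Icc (0 : ℝ) 1 else Set.Ici 0)) := by
  refine MeasurableSet.univ_pi fun ℓ => ?_
  split_ifs
  exacts [measurableSet_Icc, measurableSet_Ici]

/-- `scaleEquiv i` preserves the outer set. [cite: Maynard2016LargeGaps, Lemma 8 (proof)] -/
theorem scaleEquiv_mem_outer_iff {k : ℕ} (i : Fin k) (t : Fin k → ℝ) :
    scaleEquiv i t ∈ Set.univ.pi (fun ℓ : Fin k => if ℓ = i then Set.Icc (0 : ℝ) 1 else Set.Ici 0) ↔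
      t ∈ Set.univ.pi (fun ℓ : Fin k => if ℓ = i then Set.Icc (0 : ℝ) 1 else Set.Ici 0) := by
  simp only [Set.mem_univ_pi]
  refine forall_congr' fun ℓ => ?_
  rw [scaleEquiv_apply]
  unfold scaleVec
  by_cases h : ℓ = i
  · rw [if_pos h, if_pos h, one_mul]
  · rw [if_neg h, if_neg h, Set.mem_Ici, Set.mem_Ici]
    constructor
    · intro h'; nlinarith
    · intro h'; positivity

/-- **`∫ (∫_{u ≥ 0} F(10·(t; t_i := u)) du)² dt = 10^{−k−1} J_k^{(i)}(F)`** over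
`{t_i ∈ [0,1], t_ℓ ≥ 0 (ℓ ≠ i)}`, for `F` supported in `R_k`, `k ≥ 1`. [cite: Maynard2016LargeGaps, Lemma 8 (proof, "F_k(10t)")] -/
theorem integral_J_smul_ten {k : ℕ} (hk : 1 ≤ k) (F : (Fin k → ℝ) → ℝ)
    (hF : Function.support F ⊆ maynardSimplex k) (i : Fin k) :
    ∫ t in Set.univ.pi (fun ℓ : Fin k => if ℓ = i then Set.Icc (0 : ℝ) 1 else Set.Ici 0),
        (∫ u in Set.Ioi (0 : ℝ), F ((10 : ℝ) • Function.update t i u)) ^ 2 =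
      maynardJ k i F / 10 ^ (k + 1) := by
  obtain ⟨n, rfl⟩ : ∃ n, k = n + 1 := ⟨k - 1, by omega⟩
  set O := Set.univ.pi (fun ℓ : Fin (n + 1) => if ℓ = i then Set.Icc (0 : ℝ) 1 else Set.Ici 0)
    with hO
  -- Step 1: the inner integral
  simp_rw [inner_smul_ten F i]
  -- Step 2: to a whole-space integral of an indicator composed with `scaleEquiv`
  have h2 : ∫ t in O, (10⁻¹ * fibreInt F i (scaleEquiv i t)) ^ 2 =
      ∫ t, (O.indicator fun s => (10⁻¹ * fibreInt F i s) ^ 2) (scaleEquiv i t) := by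
    rw [← integral_indicator (measurableSet_outer i)]
    refine integral_congr_ae (Eventually.of_forall fun t => ?_)
    show O.indicator (fun t => (10⁻¹ * fibreInt F i (scaleEquiv i t)) ^ 2) t =
      O.indicator (fun s => (10⁻¹ * fibreInt F i s) ^ 2) (scaleEquiv i t)
    by_cases ht : t ∈ O
    · rw [Set.indicator_of_mem ht, Set.indicator_of_mem ((scaleEquiv_mem_outer_iff i t).2 ht)]
    · rw [Set.indicator_of_notMem ht,
        Set.indicator_of_notMem (mt (scaleEquiv_mem_outer_iff i t).1 ht)]
  -- Step 3: change of variables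
  have h3 : ∫ t, (O.indicator fun s => (10⁻¹ * fibreInt F i s) ^ 2) (scaleEquiv i t) =
      (10 ^ n)⁻¹ * ∫ s in O, (10⁻¹ * fibreInt F i s) ^ 2 := by
    rw [integral_comp_scaleEquiv, integral_indicator (measurableSet_outer i)]
  -- Step 4: restrict to the cube and identify with `maynardJ`
  have h4 : ∫ s in O, (10⁻¹ * fibreInt F i s) ^ 2 = 100⁻¹ * maynardJ (n + 1) i F := by
    have h4a : ∫ s in O, (10⁻¹ * fibreInt F i s) ^ 2 = ∫ s in maynardCube (n + 1),
        (10⁻¹ * fibreInt F i s) ^ 2 := by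
      refine setIntegral_eq_of_subset_of_forall_sdiff_eq_zero (measurableSet_outer i)
        (fun s hs => Set.mem_univ_pi.2 fun ℓ => ?_) fun s hs => ?_
      · by_cases h : ℓ = i
        · rw [if_pos h]; exact hs ℓ (Set.mem_univ _)
        · rw [if_neg h]; exact Set.mem_Ici.2 (hs ℓ (Set.mem_univ _)).1
      · obtain ⟨hsO, hsC⟩ := hs
        have : ∃ ℓ, s ℓ ∉ Set.Icc (0 : ℝ) 1 := by
          by_contra h
          exact hsC (Set.mem_univ_pi.2 fun ℓ => not_not.1 fun hℓ => h ⟨ℓ, hℓ⟩)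
        obtain ⟨ℓ, hℓ⟩ := this
        have hℓi : ℓ ≠ i := by
          rintro rfl
          have := (Set.mem_univ_pi.1 hsO) ℓ
          rw [if_pos rfl] at this
          exact hℓ this
        rw [fibreInt_eq_zero hF hℓi hℓ, mul_zero, zero_pow two_ne_zero]
    rw [h4a]
    unfold maynardJ
    rw [← integral_const_mul]
    refine setIntegral_congr_fun ?_ fun s _ => ?_
    · exact MeasurableSet.univ_pi fun _ => measurableSet_Icc
    · rw [fibreInt_eq_intervalIntegral hF, mul_pow]
      norm_num
  rw [h2, h3, h4, pow_succ, pow_succ]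
  field_simp
  ring

/-! ### The approximation step in scaled form -/

/-- **Maynard 2016, Lemma 8, approximation step (scaled form)**: for every non-negative admissible
`F` on `R_k` (`k ≥ 1`) and `ε > 0` there are `J`, `c_j > 0` and bump data `(w, φ)` such that
`Σ_j c_j ∏_ℓ φ_{ℓ,j}(t_ℓ)` has its two functionals (`∫_{t≥0}(·)²` and
`∫ (∫_{u≥0} ·(t; t_i:=u) du)²` over `{t_i∈[0,1], t_ℓ≥0}`) within `ε` of those of `t ↦ F(10t)`
("`F` is a smooth approximation to `F_k(10t_1,…,10t_k)` [...] `L²` dense"). Named fact, not proved here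
(grid histograms + the smoothed cells `cellBump`, and the `L²`-continuity of the two functionals on
functions supported in `Σ t_i ≤ 1/10`). [cite: Maynard2016LargeGaps, Lemma 8 (proof, approximation step)] -/
def ScaledDensity : Prop :=
  ∀ k : ℕ, 1 ≤ k → ∀ F : (Fin k → ℝ) → ℝ, IsMaynardAdmissible k F → (∀ t, 0 ≤ F t) →
    ∀ ε : ℝ, 0 < ε →
      ∃ (J : ℕ) (c : Fin J → ℝ) (w : Fin k → Fin J → ℝ) (φ : Fin k → Fin J → ℝ → ℝ),
        (∀ j, 0 < c j) ∧ IsBumpData k J w φ ∧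
          |(∫ t in Set.univ.pi (fun _ : Fin k => Set.Ici (0 : ℝ)), bumpSum c φ t ^ 2) -
              ∫ t in Set.univ.pi (fun _ : Fin k => Set.Ici (0 : ℝ)), F ((10 : ℝ) • t) ^ 2| ≤ ε ∧
            ∀ i, |(∫ t in Set.univ.pi (fun ℓ : Fin k => if ℓ = i then Set.Icc (0 : ℝ) 1
                  else Set.Ici 0),
                (∫ u in Set.Ioi (0 : ℝ), bumpSum c φ (Function.update t i u)) ^ 2) -
              ∫ t in Set.univ.pi (fun ℓ : Fin k => if ℓ = i then Set.Icc (0 : ℝ) 1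
                  else Set.Ici 0),
                (∫ u in Set.Ioi (0 : ℝ), F ((10 : ℝ) • Function.update t i u)) ^ 2| ≤ ε

/-- **`BumpDensity` from its scaled form, PROVED** (by `integral_sq_smul_ten`, `integral_J_smul_ten`).
[cite: Maynard2016LargeGaps, Lemma 8 (proof, "F_k(10t)")] -/
theorem bumpDensity_of_scaledDensity (hS : ScaledDensity) : BumpDensity := by
  intro k hk F hF hF0 ε hε
  obtain ⟨J, c, w, φ, hc, hφ, hI, hJ⟩ := hS k hk F hF hF0 ε hε
  refine ⟨J, c, w, φ, hc, hφ, ?_, fun i => ?_⟩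
  · rwa [integral_sq_smul_ten F hF.support_subset] at hI
  · have := hJ i
    rwa [integral_J_smul_ten hk F hF.support_subset i] at this

/-- `Lemma8Density` from the scaled form. [cite: Maynard2016LargeGaps, Lemma 8 (proof)] -/
theorem lemma8Density_of_scaledDensity (hS : ScaledDensity) : Lemma8Density :=
  lemma8Density_of_bumpDensity (bumpDensity_of_scaledDensity hS)

/-- **Maynard's Theorem 1 from `Lemma7` and `ScaledDensity`.** [cite: Maynard2016LargeGaps, Theorem 1] -/
theorem theorem1_of_lemma7_scaledDensity (h7 : Lemma7) (hS : ScaledDensity) :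
    Literature.NumberTheory.Sieve.Maynard2016_theorem1 :=
  theorem1_of_lemma7_bumpDensity h7 (bumpDensity_of_scaledDensity hS)

/-- **`∀ c, RankinConstant c` from `Lemma7` and `ScaledDensity`.** [cite: Maynard2016LargeGaps, Theorem 1] -/
theorem forall_rankinConstant_of_lemma7_scaledDensity (h7 : Lemma7) (hS : ScaledDensity) (c : ℝ) :
    Literature.NumberTheory.Sieve.RankinConstant c :=
  forall_rankinConstant_of_lemma7_bumpDensity h7 (bumpDensity_of_scaledDensity hS) c

end Maynard2016

end Literature.NumberTheory.Sieve
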